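import Literature.Analysis.FluidPDE.PineauVicolWeightedIdentity
import Literature.Analysis.FluidPDE.TsaiProfileEndgame
import Literature.Analysis.FluidPDE.AncientSimilarityVariables
import HarnessLib

/-!
# Helpers for the Gaussian enstrophy identity — crux stmt-NavierStokesRegularity-1404
  (`QuantisedSymmetry.PolyhedralDssProfileExists`), line polyhedral_cell, stub
  stub_gaussianEnstrophyIdentity (N10)

Tools for the registered stub `stub_gaussianEnstrophyIdentity` (landed separately); this file
lands the registered sub-goal `stub_gaussianEnstrophySliceBernoulli` (step (i) of N10).

* `gaussEnstrophy_integral_weight_mul_drift` — the whole-space integration by parts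
  `∫ w (−ΔH + DH[b]) = −∫ H (Δw + div(w b))` for `H, w ∈ C²`, `b ∈ C¹` under integrability of
  `w LH`, `H (Δw + div(w b))`, `|w||∇H|`, `|H||∇w|`, `|H||w||b|` (the tree's
  `PineauVicol2026.integral_weight_mul_drift_eq_zero` is the case `Δw + div(w b) = 0`; same proof:
  the cut-off identity `integral_cutoff_mul_weight_mul_drift`, `O(1/R)` cut-off gradients,
  dominated convergence).
* the Gaussian weight `w₀ = e^{−|y|²/4} = gaussProfile (−1/4)`: `Dw₀(y)v = −½ w₀ ⟪y, v⟫`,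
  `‖∇w₀‖ ≤ ½|y| w₀`, and the KEY COMPUTATION `Δw₀ + div(w₀ (U + ½y)) = −½ ⟪y, U⟫ w₀` for
  `div U = 0` (`L*w₀ = ½ (y·U) w₀` for the formal adjoint `L* = −Δ − (U + y/2)·∇ − 3/2`).
* slices of the backward Leray system on `ℝ × ℝ³`: the pressure Poisson equation in coordinates
  (`ΔP = −tr((∇U)²)` from `laplacian_pressure_eq_of_isClassicalNSSolutionOn`, Leray's drift force
  being divergence free) and the pointwise Bernoulli identity
  `|curl U|² = (ΔΠ − DΠ[U + ½y]) − ⟪U + ½y, ∂ₛU⟫`, `Π = headPressure ½ U P`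
  (`PineauVicol2026.bernoulli_identity_rdss` with `α = 0`).
* Gaussian × polynomial integrability on `ℝ³` and on `(0, S] × ℝ³`; the stub's bounds lifted to
  one majorant (`gaussEnstrophy_atoms`).

## References

* B. Pineau, V. Vicol, arXiv:2607.09619 (2026), (4.3), (5.1)–(5.4), (7.7)–(7.10). [PineauVicol2026]
* T.-P. Tsai, ARMA 143 (1998), (1.7). [Tsai1998]
-/

noncomputable section

-- the summit namespace `…NavierStokesRegularity.NavierStokesRegularity…` is the tree convention (D-0017)
set_option linter.dupNamespace false

namespace Summit.NavierStokesRegularity.NavierStokesRegularity.Theorems.PolyhedralDssProfileExists.PolyhedralCell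

open MeasureTheory Set Function Filter Topology
open Literature.Analysis Literature.Analysis.FluidPDE
open scoped InnerProductSpace RealInnerProductSpace Laplacian ContDiff

section General

variable {E : Type*} [NormedAddCommGroup E] [InnerProductSpace ℝ E] [FiniteDimensional ℝ E]
  [MeasurableSpace E] [BorelSpace E]

/-- **Integration against a weight, with a source.** Let `H, w ∈ C²`, `b ∈ C¹` on a
finite-dimensional inner product space, and write `g := Δw + div(w b)` (minus the formal adjoint of
`L = −Δ + b·∇` applied to `w`). If `w LH = w(−ΔH + DH[b])`, `H g`, `|w||∇H|`, `|H||∇w|`, `|H||w||b|`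
are integrable, then `∫ w (−ΔH + DH[b]) = −∫ H g` (three boundary-free integrations by parts:
the cut-off identity `integral_cutoff_mul_weight_mul_drift` with the tree's cut-offs `cutoff R`,
whose gradients are `O(1/R)`, and dominated convergence as `R → ∞`; the tree's
`integral_weight_mul_drift_eq_zero` is the case `g = 0`).
[cite: PineauVicol2026, (5.4) (p. 13), footnote 16 (p. 12), (7.10) (p. 26)] -/
theorem gaussEnstrophy_integral_weight_mul_drift {H w g : E → ℝ} {b : E → E} (hH : ContDiff ℝ 2 H)
    (hw : ContDiff ℝ 2 w) (hb : ContDiff ℝ 1 b)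
    (hker : ∀ x, (Δ w) x + VectorCalculus.divergence (fun y => w y • b y) x = g x)
    (hint : Integrable (fun x => w x * (-(Δ H) x + fderiv ℝ H x (b x))))
    (hHg : Integrable (fun x => H x * g x))
    (h₁ : Integrable (fun x => |w x| * ‖gradient H x‖))
    (h₂ : Integrable (fun x => |H x| * ‖gradient w x‖))
    (h₃ : Integrable (fun x => |H x| * |w x| * ‖b x‖)) :
    ∫ x, w x * (-(Δ H) x + fderiv ℝ H x (b x)) = -∫ x, H x * g x := by
  haveI : CompleteSpace E := FiniteDimensional.complete ℝ E
  obtain ⟨C, hC0, hC⟩ := exists_norm_fderiv_cutoff_le (E := E)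
  set K : ℝ := ∫ x, (|w x| * ‖gradient H x‖ + |H x| * ‖gradient w x‖ + |H x| * |w x| * ‖b x‖)
    with hK
  set f : E → ℝ := fun x => w x * (-(Δ H) x + fderiv ℝ H x (b x)) + H x * g x with hf
  have hgc : Continuous g := by
    have e : g = fun x => (Δ w) x + VectorCalculus.divergence (fun y => w y • b y) x :=
      funext fun x => (hker x).symm
    rw [e]
    exact (continuous_laplacian hw).add (continuous_divergence
      (((hw.of_le (by norm_num)).smul hb).continuous_fderiv one_ne_zero))
  have hfc : Continuous f :=
    (hw.continuous.mul ((continuous_laplacian hH).neg.add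
      ((hH.continuous_fderiv (by norm_num)).clm_apply hb.continuous))).add (hH.continuous.mul hgc)
  have hfi : Integrable f := hint.add hHg
  -- the cut-off integrals
  have hcutI : ∀ n : ℕ, ∫ x, cutoff ((n : ℝ) + 1) x * f x =
      ∫ x, (w x * ⟪gradient H x, gradient (cutoff ((n : ℝ) + 1)) x⟫ -
        H x * ⟪gradient w x, gradient (cutoff ((n : ℝ) + 1)) x⟫ -
        H x * w x * ⟪b x, gradient (cutoff ((n : ℝ) + 1)) x⟫) := by
    intro n
    have hR : (0 : ℝ) < n + 1 := by positivity
    have hχc : Continuous (cutoff (E := E) ((n : ℝ) + 1)) := (contDiff_cutoff (n := 1) _).continuous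
    have hχb : ∀ᵐ x ∂(volume : Measure E), ‖cutoff ((n : ℝ) + 1) x‖ ≤ 1 :=
      Eventually.of_forall fun x => by rw [Real.norm_eq_abs]; exact abs_cutoff_le_one _ _
    have iA : Integrable fun x => cutoff ((n : ℝ) + 1) x * (w x * (-(Δ H) x + fderiv ℝ H x (b x))) :=
      hint.bdd_mul hχc.aestronglyMeasurable hχb
    have iB : Integrable fun x => cutoff ((n : ℝ) + 1) x * (H x * g x) :=
      hHg.bdd_mul hχc.aestronglyMeasurable hχb
    have e : (fun x => cutoff ((n : ℝ) + 1) x * f x) = fun x =>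
        cutoff ((n : ℝ) + 1) x * (w x * (-(Δ H) x + fderiv ℝ H x (b x))) +
          cutoff ((n : ℝ) + 1) x * (H x * g x) := funext fun x => by simp only [hf]; ring
    rw [e, integral_add iA iB, PineauVicol2026.integral_cutoff_mul_weight_mul_drift H w
      (cutoff ((n : ℝ) + 1)) b hH hw hb (contDiff_cutoff (n := 1) _) (hasCompactSupport_cutoff hR)]
    simp only [hker]
    ring
  -- bound on the cut-off integrals: `≤ C K / (n+1)`
  have hbound : ∀ n : ℕ, ‖∫ x, cutoff ((n : ℝ) + 1) x * f x‖ ≤ C / ((n : ℝ) + 1) * K := by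
    intro n
    have hR : (0 : ℝ) < n + 1 := by positivity
    rw [hcutI n, hK, ← integral_const_mul]
    refine norm_integral_le_of_norm_le (((h₁.add h₂).add h₃).const_mul _)
      (Eventually.of_forall fun x => ?_)
    have hg : ‖gradient (cutoff ((n : ℝ) + 1)) x‖ ≤ C / ((n : ℝ) + 1) := by
      rw [show ‖gradient (cutoff ((n : ℝ) + 1)) x‖ = ‖fderiv ℝ (cutoff ((n : ℝ) + 1)) x‖ by
        rw [gradient, LinearIsometryEquiv.norm_map]]
      exact hC _ hR x
    have e1 : |w x * ⟪gradient H x, gradient (cutoff ((n : ℝ) + 1)) x⟫| ≤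
        C / ((n : ℝ) + 1) * (|w x| * ‖gradient H x‖) := by
      rw [abs_mul]
      calc |w x| * |⟪gradient H x, gradient (cutoff ((n : ℝ) + 1)) x⟫|
          ≤ |w x| * (‖gradient H x‖ * ‖gradient (cutoff ((n : ℝ) + 1)) x‖) :=
            mul_le_mul_of_nonneg_left (abs_real_inner_le_norm _ _) (abs_nonneg _)
        _ ≤ |w x| * (‖gradient H x‖ * (C / ((n : ℝ) + 1))) := by gcongr
        _ = C / ((n : ℝ) + 1) * (|w x| * ‖gradient H x‖) := by ring
    have e2 : |H x * ⟪gradient w x, gradient (cutoff ((n : ℝ) + 1)) x⟫| ≤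
        C / ((n : ℝ) + 1) * (|H x| * ‖gradient w x‖) := by
      rw [abs_mul]
      calc |H x| * |⟪gradient w x, gradient (cutoff ((n : ℝ) + 1)) x⟫|
          ≤ |H x| * (‖gradient w x‖ * ‖gradient (cutoff ((n : ℝ) + 1)) x‖) :=
            mul_le_mul_of_nonneg_left (abs_real_inner_le_norm _ _) (abs_nonneg _)
        _ ≤ |H x| * (‖gradient w x‖ * (C / ((n : ℝ) + 1))) := by gcongr
        _ = C / ((n : ℝ) + 1) * (|H x| * ‖gradient w x‖) := by ring
    have e3 : |H x * w x * ⟪b x, gradient (cutoff ((n : ℝ) + 1)) x⟫| ≤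
        C / ((n : ℝ) + 1) * (|H x| * |w x| * ‖b x‖) := by
      rw [abs_mul, abs_mul]
      calc |H x| * |w x| * |⟪b x, gradient (cutoff ((n : ℝ) + 1)) x⟫|
          ≤ |H x| * |w x| * (‖b x‖ * ‖gradient (cutoff ((n : ℝ) + 1)) x‖) :=
            mul_le_mul_of_nonneg_left (abs_real_inner_le_norm _ _) (by positivity)
        _ ≤ |H x| * |w x| * (‖b x‖ * (C / ((n : ℝ) + 1))) := by gcongr
        _ = C / ((n : ℝ) + 1) * (|H x| * |w x| * ‖b x‖) := by ring
    rw [Real.norm_eq_abs]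
    calc |w x * ⟪gradient H x, gradient (cutoff ((n : ℝ) + 1)) x⟫ -
          H x * ⟪gradient w x, gradient (cutoff ((n : ℝ) + 1)) x⟫ -
          H x * w x * ⟪b x, gradient (cutoff ((n : ℝ) + 1)) x⟫|
        ≤ |w x * ⟪gradient H x, gradient (cutoff ((n : ℝ) + 1)) x⟫| +
          |H x * ⟪gradient w x, gradient (cutoff ((n : ℝ) + 1)) x⟫| +
          |H x * w x * ⟪b x, gradient (cutoff ((n : ℝ) + 1)) x⟫| :=
          (abs_sub _ _).trans (add_le_add (abs_sub _ _) le_rfl)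
      _ ≤ C / ((n : ℝ) + 1) * (|w x| * ‖gradient H x‖) +
          C / ((n : ℝ) + 1) * (|H x| * ‖gradient w x‖) +
          C / ((n : ℝ) + 1) * (|H x| * |w x| * ‖b x‖) := add_le_add (add_le_add e1 e2) e3
      _ = C / ((n : ℝ) + 1) *
          (|w x| * ‖gradient H x‖ + |H x| * ‖gradient w x‖ + |H x| * |w x| * ‖b x‖) := by ring
  -- the cut-off integrals tend to `∫ f` (dominated convergence) ...
  have hlim : Tendsto (fun n : ℕ => ∫ x, cutoff ((n : ℝ) + 1) x * f x) atTop (𝓝 (∫ x, f x)) := by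
    refine tendsto_integral_of_dominated_convergence (fun x => ‖f x‖) (fun n => ?_) hfi.norm
      (fun n => Eventually.of_forall fun x => ?_) (Eventually.of_forall fun x => ?_)
    · exact ((contDiff_cutoff (n := 1) _).continuous.mul hfc).aestronglyMeasurable
    · rw [norm_mul, Real.norm_eq_abs]
      exact mul_le_of_le_one_left (norm_nonneg _) (abs_cutoff_le_one _ _)
    · simpa using (tendsto_cutoff_natCast_add_one x).mul_const (f x)
  -- ... and to `0`
  have hlim0 : Tendsto (fun n : ℕ => ∫ x, cutoff ((n : ℝ) + 1) x * f x) atTop (𝓝 0) := by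
    have hK0 : Tendsto (fun n : ℕ => C / ((n : ℝ) + 1) * K) atTop (𝓝 0) := by
      have h1 : Tendsto (fun n : ℕ => C / ((n : ℝ) + 1)) atTop (𝓝 0) :=
        tendsto_const_nhds.div_atTop (tendsto_natCast_atTop_atTop.atTop_add tendsto_const_nhds)
      simpa using h1.mul_const K
    exact squeeze_zero_norm hbound hK0
  have h0 : ∫ x, f x = 0 := tendsto_nhds_unique hlim hlim0
  rw [hf, integral_add hint hHg] at h0
  linarith

/-! ### The Gaussian weight `w₀ = e^{−|y|²/4} = gaussProfile (−1/4)` -/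

omit [FiniteDimensional ℝ E] [MeasurableSpace E] [BorelSpace E] in
/-- `Dw₀(y) v = −½ w₀(y) ⟪y, v⟫` for `w₀ = e^{−|y|²/4}`. [folklore] -/
theorem gaussEnstrophy_fderiv_weight_apply (y v : E) :
    fderiv ℝ (gaussProfile (-(1 / 4 : ℝ))) y v =
      -(1 / 2 : ℝ) * gaussProfile (-(1 / 4 : ℝ)) y * ⟪y, v⟫ := by
  rw [fderiv_gaussProfile_apply]
  ring

omit [MeasurableSpace E] [BorelSpace E] in
/-- `‖∇w₀(y)‖ ≤ ½ |y| w₀(y)` for `w₀ = e^{−|y|²/4}`. [folklore] -/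
theorem gaussEnstrophy_norm_gradient_weight_le (y : E) :
    ‖gradient (gaussProfile (-(1 / 4 : ℝ))) y‖ ≤ (1 / 2 : ℝ) * ‖y‖ * gaussProfile (-(1 / 4 : ℝ)) y := by
  haveI : CompleteSpace E := FiniteDimensional.complete ℝ E
  have hw : 0 < gaussProfile (-(1 / 4 : ℝ)) y := Real.exp_pos _
  rw [show ‖gradient (gaussProfile (-(1 / 4 : ℝ))) y‖ = ‖fderiv ℝ (gaussProfile (-(1 / 4 : ℝ))) y‖ by
    rw [gradient, LinearIsometryEquiv.norm_map]]
  refine ContinuousLinearMap.opNorm_le_bound _ (by positivity) fun v => ?_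
  rw [gaussEnstrophy_fderiv_weight_apply, Real.norm_eq_abs, abs_mul, abs_mul, abs_neg,
    abs_of_pos hw, abs_of_pos (by norm_num : (0 : ℝ) < 1 / 2)]
  calc 1 / 2 * gaussProfile (-(1 / 4 : ℝ)) y * |⟪y, v⟫|
      ≤ 1 / 2 * gaussProfile (-(1 / 4 : ℝ)) y * (‖y‖ * ‖v‖) :=
        mul_le_mul_of_nonneg_left (abs_real_inner_le_norm _ _) (by positivity)
    _ = 1 / 2 * ‖y‖ * gaussProfile (-(1 / 4 : ℝ)) y * ‖v‖ := by ring

omit [MeasurableSpace E] [BorelSpace E] in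
/-- **The key computation `L*w₀ = ½ (y·U) w₀`.** For `w₀ = e^{−|y|²/4}` and a field `U`
differentiable at `y` with `div U(y) = 0`:
`Δw₀(y) + div(w₀ (U + ½·))(y) = −½ ⟪y, U(y)⟫ w₀(y)` (since `∇w₀ = −½ w₀ y`,
`Δw₀ = (|y|²/4 − d/2) w₀`, `div(w₀ b) = ⟪∇w₀, b⟫ + w₀ div b`, `div(½ y) = d/2`).
[cite: PineauVicol2026, (5.1) (p. 12)] -/
theorem gaussEnstrophy_weight_kernel {U : E → E} {y : E} (hU : DifferentiableAt ℝ U y)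
    (hdiv : VectorCalculus.divergence U y = 0) :
    (Δ (gaussProfile (E := E) (-(1 / 4 : ℝ)))) y +
        VectorCalculus.divergence
          (fun z => gaussProfile (-(1 / 4 : ℝ)) z • (U z + (1 / 2 : ℝ) • z)) y =
      -(1 / 2 : ℝ) * ⟪y, U y⟫ * gaussProfile (-(1 / 4 : ℝ)) y := by
  haveI : CompleteSpace E := FiniteDimensional.complete ℝ E
  have hw : DifferentiableAt ℝ (gaussProfile (E := E) (-(1 / 4 : ℝ))) y :=
    ((contDiff_gaussProfile (E := E) (-(1 / 4 : ℝ)) (n := 1)).differentiable one_ne_zero) y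
  have hid : DifferentiableAt ℝ (fun z : E => (1 / 2 : ℝ) • z) y :=
    differentiableAt_fun_id.const_smul _
  have hb : DifferentiableAt ℝ (fun z : E => U z + (1 / 2 : ℝ) • z) y := hU.add hid
  have hdivid : VectorCalculus.divergence (fun z : E => z) y = (Module.finrank ℝ E : ℝ) := by
    simp only [VectorCalculus.divergence, fderiv_fun_id, ContinuousLinearMap.coe_id,
      LinearMap.trace_id]
  have hdivb : VectorCalculus.divergence (fun z : E => U z + (1 / 2 : ℝ) • z) y =
      (Module.finrank ℝ E : ℝ) / 2 := by
    rw [divergence_add_apply hU hid, divergence_const_smul_apply differentiableAt_fun_id, hdiv,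
      hdivid]
    ring
  have hgrad : ⟪U y + (1 / 2 : ℝ) • y, gradient (gaussProfile (-(1 / 4 : ℝ))) y⟫ =
      -(1 / 2 : ℝ) * gaussProfile (-(1 / 4 : ℝ)) y * (⟪y, U y⟫ + (1 / 2 : ℝ) * ‖y‖ ^ 2) := by
    rw [real_inner_comm, gradient, InnerProductSpace.toDual_symm_apply,
      gaussEnstrophy_fderiv_weight_apply, inner_add_right, real_inner_smul_right,
      real_inner_self_eq_norm_sq]
  rw [divergence_smul_apply hw hb, hdivb, hgrad, laplacian_gaussProfile]
  ring

end General

/-! ### Slices of the backward Leray system on `ℝ × ℝ³` -/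

section Slice

variable {U : ℝ → EuclideanSpace ℝ (Fin 3) → EuclideanSpace ℝ (Fin 3)}
  {P : ℝ → EuclideanSpace ℝ (Fin 3) → ℝ}

/-- **Pressure Poisson equation of the backward Leray system, in coordinates.** For a classical
solution of `∂ₛU + ½U + ½(y·∇)U + (U·∇)U + ∇P = ΔU`, `div U = 0` on `ℝ × ℝ³` and every `s`,
`∑ₗ ∂ₗ∂ₗP(s) = −∑ₗⱼ ∂ₗUⱼ(s) ∂ⱼUₗ(s)`: the tree's pressure Poisson equation
`ΔP = −div((U·∇)U) + div f` (`laplacian_pressure_eq_of_isClassicalNSSolutionOn`) for Leray's drift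
force `f = −½(U + (y·∇)U)`, which is divergence free (`div((y·∇)U) = div U + (y·∇)div U = 0`),
and `div((U·∇)U) = tr((∇U)²)` for `div U = 0`. [cite: Tsai1998, (2.1) (p. 34)] -/
theorem gaussEnstrophy_sum_pderiv_pderiv_pressure (h : IsBackwardLeraySolutionOn Set.univ 1 U P)
    (s : ℝ) (y : EuclideanSpace ℝ (Fin 3)) :
    ∑ l, pderiv l (pderiv l (P s)) y =
      -∑ l, ∑ j, pderiv l (fun z => U s z j) y * pderiv j (fun z => U s z l) y := by
  have hU : ContDiff ℝ ∞ (U s) := h.contDiff_velocity (mem_univ s)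
  have hP : ContDiff ℝ ∞ (P s) := h.contDiff_pressure (mem_univ s)
  have hU2 : ContDiff ℝ 2 (U s) := hU.of_le (by norm_cast)
  have hP2 : ContDiff ℝ 2 (P s) := hP.of_le (by norm_cast)
  have hdiv : VectorCalculus.IsDivFree (U s) := h.divFree s (mem_univ s)
  have hUd : Differentiable ℝ (U s) := hU.differentiable (by simp)
  have hDUd : Differentiable ℝ (fderiv ℝ (U s)) :=
    (hU2.fderiv_right (m := 1) le_rfl).differentiable one_ne_zero
  -- the pressure Poisson equation, trace form
  have hΔ : (Δ (P s)) y = -traceCLM ((fderiv ℝ (U s) y).comp (fderiv ℝ (U s) y)) := by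
    have h1 := laplacian_pressure_eq_of_isClassicalNSSolutionOn h (t := s) (by simp) y
    have hdrift : DifferentiableAt ℝ (fun z => fderiv ℝ (U s) z z) y :=
      (hDUd y).clm_apply differentiableAt_fun_id
    have hsum : DifferentiableAt ℝ (fun z => U s z + fderiv ℝ (U s) z z) y := (hUd y).add hdrift
    have hforce : VectorCalculus.divergence (rescaledEulerLerayForce 1 U s) y = 0 := by
      have e : rescaledEulerLerayForce 1 U s =
          fun z => (-(1 / 2 : ℝ)) • (U s z + fderiv ℝ (U s) z z) := by
        funext z
        rw [rescaledEulerLerayForce_apply, ← neg_smul]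
      rw [e, divergence_const_smul_apply hsum, divergence_add_apply (hUd y) hdrift,
        hdiv y, divergence_fderiv_apply_self_eq_zero hU2 hdiv y]
      ring
    rw [h1, hforce, add_zero, divergence_convect_self_eq hU2 hdiv y]
  -- coordinates
  have hD : ∀ j i : Fin 3, fderiv ℝ (U s) y (EuclideanSpace.single j 1) i =
      pderiv j (fun z => U s z i) y := fun j i => by
    rw [pderiv_apply, euclidean_fderiv_apply_comp (hUd y)]
  rw [← laplacian_eq_sum_pderiv_pderiv' hP2 y, hΔ,
    traceCLM_comp_self_eq_sum_sum (EuclideanSpace.basisFun (Fin 3) ℝ)]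
  congr 1
  refine Finset.sum_congr rfl fun l _ => Finset.sum_congr rfl fun j _ => ?_
  simp only [EuclideanSpace.basisFun_apply, EuclideanSpace.inner_single_left, map_one, one_mul, hD]
  ring

/-- **The pointwise Bernoulli identity of a slice** (Pineau–Vicol's (7.7) with `α = 0`, Tsai's
(1.7) with the one new term `∂ₛU`): for a classical solution of the backward Leray system on
`ℝ × ℝ³` and every `(s, y)`, with the head pressure `Π = headPressure ½ U(s) P(s)` and the drift
`b = U(s) + ½y`,
`|curl U(s)(y)|² = (ΔΠ(y) − DΠ(y)[b(y)]) − ⟪b(y), ∂ₛU(s, y)⟫`.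
[cite: PineauVicol2026, (7.7) (p. 25)] -/
theorem gaussEnstrophy_norm_curl_sq_eq (h : IsBackwardLeraySolutionOn Set.univ 1 U P) (s : ℝ)
    (y : EuclideanSpace ℝ (Fin 3)) :
    ‖curl (U s) y‖ ^ 2 =
      ((Δ (headPressure (1 / 2) (U s) (P s))) y -
          fderiv ℝ (headPressure (1 / 2) (U s) (P s)) y (U s y + (1 / 2 : ℝ) • y)) -
        ⟪U s y + (1 / 2 : ℝ) • y, deriv (fun τ => U τ y) s⟫ := by
  have hU : ContDiff ℝ ∞ (U s) := h.contDiff_velocity (mem_univ s)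
  have hP : ContDiff ℝ ∞ (P s) := h.contDiff_pressure (mem_univ s)
  have hdiv : VectorCalculus.IsDivFree (U s) := h.divFree s (mem_univ s)
  have heq : ∀ z, deriv (fun τ => U τ z) s +
      (0 : ℝ) • (rotGen (U s z) - fderiv ℝ (U s) z (rotGen z)) + (1 / 2 : ℝ) • U s z +
      (1 / 2 : ℝ) • fderiv ℝ (U s) z z - (Δ (U s)) z + convect (U s) (U s) z +
      gradient (P s) z = 0 := by
    intro z
    have hm := h.momentum_leray (mem_univ s) z
    rw [timeDerivWithin_eq_deriv isOpen_univ (mem_univ s), one_smul] at hm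
    rw [zero_smul, add_zero, ← hm]
    abel
  have hB := PineauVicol2026.bernoulli_identity_rdss (α := 0) hU hP heq hdiv
    (gaussEnstrophy_sum_pderiv_pderiv_pressure h s) y
  rw [zero_mul, zero_sub, driftOp, one_mul] at hB
  linarith

/-- **Registered sub-goal (step (i) of stub N10): the slice Bernoulli identity**, in the crux
variables: for a classical solution of the backward Leray system on `ℝ × ℝ³`,
`|curl U(s)|² = (ΔΠ − DΠ[U + ½y]) − ⟪U + ½y, ∂ₛU⟫` pointwise, `Π = headPressure ½ U(s) P(s)`
(`gaussEnstrophy_norm_curl_sq_eq`; `timeDeriv U s y = ∂ₛU(s, y)`).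
[cite: PineauVicol2026, (7.7) (p. 25)] -/
theorem stub_gaussianEnstrophySliceBernoulli :
    ∀ (U : ℝ → EuclideanSpace ℝ (Fin 3) → EuclideanSpace ℝ (Fin 3)) (P : ℝ → EuclideanSpace ℝ (Fin 3) → ℝ),
      IsBackwardLeraySolutionOn Set.univ 1 U P → ∀ (s : ℝ) (y : EuclideanSpace ℝ (Fin 3)),
      ‖curl (U s) y‖ ^ 2 =
        ((Δ (headPressure (1 / 2) (U s) (P s))) y -
            fderiv ℝ (headPressure (1 / 2) (U s) (P s)) y (U s y + (1 / 2 : ℝ) • y)) -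
          ⟪U s y + (1 / 2 : ℝ) • y, timeDeriv U s y⟫_ℝ :=
  fun _ _ h s y => gaussEnstrophy_norm_curl_sq_eq h s y

end Slice

/-! ### Gaussian × polynomial integrability on `ℝ³` and on `(0, S] × ℝ³` -/

/-- A continuous function on `ℝ³` dominated by `C (1 + |y|)ᴹ e^{−|y|²/4}` is integrable
(`PineauVicol2026.integrable_one_add_norm_pow_mul_exp_neg_mul_sq`). [folklore] -/
theorem gaussEnstrophy_integrable_of_le {F : EuclideanSpace ℝ (Fin 3) → ℝ} (hF : Continuous F)
    {C : ℝ} {M : ℕ}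
    (hb : ∀ y, |F y| ≤ C * ((1 + ‖y‖) ^ M * gaussProfile (-(1 / 4 : ℝ)) y)) : Integrable F := by
  have hg := (PineauVicol2026.integrable_one_add_norm_pow_mul_exp_neg_mul_sq
    (E := EuclideanSpace ℝ (Fin 3)) (c := 1 / 4) (by norm_num) M).const_mul C
  refine hg.mono' hF.aestronglyMeasurable (Eventually.of_forall fun y => ?_)
  rw [Real.norm_eq_abs]
  exact hb y

/-- A continuous function on `ℝ × ℝ³` dominated by `C (1 + |y|)ᴹ e^{−|y|²/4}` (uniformly in the
time variable) is integrable on `(0, S] × ℝ³`. [folklore] -/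
theorem gaussEnstrophy_integrable_prod_of_le {F : ℝ × EuclideanSpace ℝ (Fin 3) → ℝ}
    (hF : Continuous F) {C : ℝ} {M : ℕ} (S : ℝ)
    (hb : ∀ p, |F p| ≤ C * ((1 + ‖p.2‖) ^ M * gaussProfile (-(1 / 4 : ℝ)) p.2)) :
    Integrable F ((volume.restrict (Ioc 0 S)).prod volume) := by
  have hg := ((PineauVicol2026.integrable_one_add_norm_pow_mul_exp_neg_mul_sq
    (E := EuclideanSpace ℝ (Fin 3)) (c := 1 / 4) (by norm_num) M).const_mul C).comp_snd
    (volume.restrict (Ioc (0 : ℝ) S))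
  refine hg.mono' hF.aestronglyMeasurable (Eventually.of_forall fun p => ?_)
  rw [Real.norm_eq_abs]
  exact hb p


/-! ### The polynomial bounds of the stub, lifted to one majorant -/

section Atoms

variable {U : ℝ → EuclideanSpace ℝ (Fin 3) → EuclideanSpace ℝ (Fin 3)}
  {P : ℝ → EuclideanSpace ℝ (Fin 3) → ℝ} {K : ℝ} {N : ℕ}

/-- **Atoms.** The polynomial bounds of the stub, lifted to the common majorant
`A(y) = (|K| + 1)(1 + |y|)ᴺ⁺¹ ≥ max(1, |y|)`. [folklore] -/
theorem gaussEnstrophy_atoms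
    (hK : ∀ s y, ‖U s y‖ ≤ K * (1 + ‖y‖) ^ N ∧ ‖fderiv ℝ (U s) y‖ ≤ K * (1 + ‖y‖) ^ N ∧
      ‖timeDeriv U s y‖ ≤ K * (1 + ‖y‖) ^ N ∧ |P s y| ≤ K * (1 + ‖y‖) ^ N ∧
      ‖gradient (P s) y‖ ≤ K * (1 + ‖y‖) ^ N) (s : ℝ) (y : EuclideanSpace ℝ (Fin 3)) :
    1 ≤ (|K| + 1) * (1 + ‖y‖) ^ (N + 1) ∧ ‖y‖ ≤ (|K| + 1) * (1 + ‖y‖) ^ (N + 1) ∧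
      ‖U s y‖ ≤ (|K| + 1) * (1 + ‖y‖) ^ (N + 1) ∧
      ‖fderiv ℝ (U s) y‖ ≤ (|K| + 1) * (1 + ‖y‖) ^ (N + 1) ∧
      ‖deriv (fun τ => U τ y) s‖ ≤ (|K| + 1) * (1 + ‖y‖) ^ (N + 1) ∧
      |P s y| ≤ (|K| + 1) * (1 + ‖y‖) ^ (N + 1) ∧
      ‖gradient (P s) y‖ ≤ (|K| + 1) * (1 + ‖y‖) ^ (N + 1) := by
  obtain ⟨h1, h2, h3, h4, h5⟩ := hK s y
  have hρ : (1 : ℝ) ≤ 1 + ‖y‖ := le_add_of_nonneg_right (norm_nonneg _)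
  have hρN : (1 + ‖y‖) ^ N ≤ (1 + ‖y‖) ^ (N + 1) := pow_le_pow_right₀ hρ N.le_succ
  have hρ1 : (1 + ‖y‖) ≤ (1 + ‖y‖) ^ (N + 1) := le_self_pow₀ hρ (Nat.succ_ne_zero N)
  have hK1 : (1 : ℝ) ≤ |K| + 1 := by linarith [abs_nonneg K]
  have hlift : K * (1 + ‖y‖) ^ N ≤ (|K| + 1) * (1 + ‖y‖) ^ (N + 1) :=
    calc K * (1 + ‖y‖) ^ N ≤ (|K| + 1) * (1 + ‖y‖) ^ N :=
          mul_le_mul_of_nonneg_right (by linarith [le_abs_self K]) (by positivity)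
      _ ≤ (|K| + 1) * (1 + ‖y‖) ^ (N + 1) := mul_le_mul_of_nonneg_left hρN (by positivity)
  have hyA : ‖y‖ ≤ (|K| + 1) * (1 + ‖y‖) ^ (N + 1) :=
    calc ‖y‖ ≤ 1 + ‖y‖ := by linarith
      _ ≤ (1 + ‖y‖) ^ (N + 1) := hρ1
      _ ≤ (|K| + 1) * (1 + ‖y‖) ^ (N + 1) := le_mul_of_one_le_left (by positivity) hK1
  refine ⟨?_, hyA, h1.trans hlift, h2.trans hlift, h3.trans hlift, h4.trans hlift, h5.trans hlift⟩
  calc (1 : ℝ) ≤ (1 + ‖y‖) ^ (N + 1) := one_le_pow₀ hρ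
    _ ≤ (|K| + 1) * (1 + ‖y‖) ^ (N + 1) := le_mul_of_one_le_left (by positivity) hK1

end Atoms

end Summit.NavierStokesRegularity.NavierStokesRegularity.Theorems.PolyhedralDssProfileExists.PolyhedralCell

end
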